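import Summits.KontsevichZagierPeriods.KontsevichZagierPeriods.Theorems.RootDecompWalshStrataPtypeAtoms
import Summits.KontsevichZagierPeriods.KontsevichZagierPeriods.Theorems.RootDecompWalshStrataVertexChart03

/-!
# Root decomposition (Walsh strata), part 47 — H-type fibre discriminants I: the vertex-chart domain engine

The last fibre-discriminant class of the quadric node is `R-H` (`disc D < 0`): after a rational affine frame
the radicand is `R_H(x, y) = H(x) − m y²`, `H = e x² + g`, `m > 0`.  Neither the `x`- nor the `y`-primitive of
`√R_H` is semialgebraic (arcsin / log), so the atoms are integrated through the landed VERTEX CHART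
`Φ(v, x) = (x, √H(x)·U_m(v))` of `RootDecompWalshStrataVertexChart01–03`, under which
`γ√R_H dx dy` pulls back to the RATIONAL weight `γ·H(x)·g_m(v) dv dx` with polynomial `x`-primitive
`P(v, x) = γ·Hi(x)·g_m(v)`, `Hi = (e/3)x³ + g x`.

* 47.1 The radicand `hrad`, the polynomials `hP = H`, `hPi = Hi` (`Hi' = H`).
* 47.2 Chart inequalities: `T_m > 0`, `m·U_m² < 1` strictly inside `m v² < 1`; `V_m ∘ U_m = id`; continuity.
* 47.3 Preimages of `ℚ`-semialgebraic sets under `ℚ`-semialgebraic maps (the tree exports this only over `ℝ`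
  or privately; the proof of the private `PolarChart03` lemma is repeated).
* 47.4 The chart domain `hDom e g m U = {(v, x) | m v² < 1, H(x) > 0, Φ(v, x) ∈ U}`: semialgebraic, open,
  charts exactly `U ⊆ {R_H > 0}` (inverse `v = V_m(y/√H(x))`), lies in the open unit square when
  `U ⊆ {0 < x < 1, 0 < y}` and `m ≥ 1`; its frontier points satisfy the closed chart inequalities and, where
  the strict ones hold, chart into `closure U \ U`.
* 47.5 The potential `hpot` and the RAW-SECTION ENGINE `InBaker.of_Hhalf`: rule (2) along the chart
  (`vchart_mem_relations`), then the landed `InBaker.of_planar_sections` (rule (3) in `x`, CAD in `v`);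
  what remains are the boundary-section terms `[S, P(v, ζ(v))]`, typed in part 48.

References: [KontsevichZagier2001 §1.2 rules (1)–(3)], [BCR1998 §2.2, Prop. 2.2.7].
-/
noncomputable section
/-- `(snoc (init z) s) 0 = z 0` (file-local copy; public twin privatised at landing, dedup). [bookkeeping] -/ private theorem snoc_init_zero (z : Fin 2 → ℝ) (s : ℝ) : (Fin.snoc (Fin.init z) s : Fin 2 → ℝ) 0 = z 0 := by rw [show (0 : Fin 2) = Fin.castSucc (0 : Fin 1) from rfl, Fin.snoc_castSucc]; rfl
/-- `(snoc (init z) s) 1 = s` (file-local copy). [bookkeeping] -/ private theorem snoc_init_one (z : Fin 2 → ℝ) (s : ℝ) : (Fin.snoc (Fin.init z) s : Fin 2 → ℝ) 1 = s := by rw [show (1 : Fin 2) = Fin.last 1 from rfl, Fin.snoc_last]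

open Set MeasureTheory MvPolynomial Literature.NumberTheory.Transcendental
open Literature.ModelTheory.ExponentialFields (IsSemialgebraic isSemialgebraic_univ isSemialgebraic_empty)
open Summit.KontsevichZagierPeriods.RootDecompWalshStrata.ConicDescent.VertexChart

namespace Summit.KontsevichZagierPeriods.RootDecompWalshStrata.ConicDescent.BallCube

/-! #### 47.1 The H-type radicand and its polynomials -/

/-- `H = eX² + g ∈ ℚ[X]`: the `x`-part of the H-type radicand `e x² + g − m y²`. [this node] -/
def hP (e g : ℚ) : Polynomial ℚ := Polynomial.C e * Polynomial.X ^ 2 + Polynomial.C g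

/-- `Hi = (e/3)X³ + gX`, the primitive of `H` vanishing at `0`. [this node] -/
def hPi (e g : ℚ) : Polynomial ℚ :=
  Polynomial.C (e / 3) * Polynomial.X ^ 3 + Polynomial.C g * Polynomial.X

/-- `H(x) = e x² + g`. [bookkeeping] -/
theorem aeval_hP (e g : ℚ) (x : ℝ) : Polynomial.aeval x (hP e g) = (e : ℝ) * x ^ 2 + g := by
  simp [hP]

/-- `Hi(x) = (e/3)x³ + g x`. [bookkeeping] -/
theorem aeval_hPi (e g : ℚ) (x : ℝ) :
    Polynomial.aeval x (hPi e g) = (e : ℝ) / 3 * x ^ 3 + g * x := by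
  simp [hPi]

/-- `Hi' = H`. [calculus] -/
theorem derivative_hPi (e g : ℚ) : Polynomial.derivative (hPi e g) = hP e g := by
  simp only [hPi, hP, Polynomial.derivative_add, Polynomial.derivative_C_mul_X_pow,
    Polynomial.derivative_C_mul_X]
  norm_num

/-- The H-type radicand `R_H(x, y) = e x² + g − m y²` (`u 0 = x`, `u 1 = y`). [this node] -/
def hrad (e g m : ℚ) (u : Fin 2 → ℝ) : ℝ := (e : ℝ) * u 0 ^ 2 + g - m * u 1 ^ 2

/-- `R_H` in the vertex-chart format `H(x) − m(y − Y₀(x))²` with `Y₀ = 0`. [bookkeeping] -/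
theorem hrad_eq_vertex (e g m : ℚ) (u : Fin 2 → ℝ) :
    Polynomial.aeval (u 0) (hP e g) - m * (u 1 - Polynomial.aeval (u 0) (0 : Polynomial ℚ)) ^ 2 =
      hrad e g m u := by
  rw [aeval_hP, map_zero, sub_zero, hrad]

/-! #### 47.2 Chart inequalities and continuity -/

section chart

variable {m : ℚ}

/-- `U_m` is continuous. [calculus] -/
theorem continuous_gU (hm : 0 ≤ m) : Continuous (gU m) := by
  have h : Continuous fun v : ℝ => 2 * v / (1 + (m : ℝ) * v ^ 2) :=
    Continuous.div (by fun_prop) (by fun_prop) fun v => (one_add_pos hm v).ne'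
  exact h

/-- `g_m` is continuous. [calculus] -/
theorem continuous_gW (hm : 0 ≤ m) : Continuous (gW m) := by
  have h : Continuous fun v : ℝ => 2 * (1 - (m : ℝ) * v ^ 2) ^ 2 / (1 + (m : ℝ) * v ^ 2) ^ 3 :=
    Continuous.div (by fun_prop) (by fun_prop) fun v => (pow_pos (one_add_pos hm v) 3).ne'
  exact h

/-- `√H` is continuous. [calculus] -/
theorem continuous_vS (H : Polynomial ℚ) : Continuous (vS H) :=
  (Polynomial.continuous_aeval (p := H)).sqrt

/-- The vertex chart is continuous. [calculus] -/
theorem continuous_vΦ (hm : 0 ≤ m) (Y₀ H : Polynomial ℚ) : Continuous (vΦ m Y₀ H) := by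
  refine continuous_pi fun i => ?_
  have hi : i = 0 ∨ i = 1 := by fin_cases i <;> simp
  rcases hi with rfl | rfl
  · exact (continuous_apply 1).congr fun p => (vΦ_zero p).symm
  · exact (((Polynomial.continuous_aeval (p := Y₀)).comp (continuous_apply 1)).add
      (((continuous_vS H).comp (continuous_apply 1)).mul
        ((continuous_gU hm).comp (continuous_apply 0)))).congr fun p => (vΦ_one p).symm

/-- `T_m(v) > 0` strictly inside `m v² < 1`. [bookkeeping] -/
theorem gT_pos (hm : 0 ≤ m) {v : ℝ} (hv : (m : ℝ) * v ^ 2 < 1) : 0 < gT m v := by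
  unfold gT
  exact div_pos (by linarith) (one_add_pos hm v)

/-- `m·U_m(v)² < 1` strictly inside `m v² < 1`. [bookkeeping] -/
theorem m_gU_sq_lt (hm : 0 ≤ m) {v : ℝ} (hv : (m : ℝ) * v ^ 2 < 1) : (m : ℝ) * gU m v ^ 2 < 1 := by
  have h := gT_sq_add hm v
  have h' := gT_pos hm hv
  nlinarith

/-- `U_m(v) > 0` for `v > 0`. [bookkeeping] -/
theorem gU_pos (hm : 0 ≤ m) {v : ℝ} (hv : 0 < v) : 0 < gU m v := by
  unfold gU
  exact div_pos (by linarith) (one_add_pos hm v)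

/-- `U_m(v) > 0` forces `v > 0`. [bookkeeping] -/
theorem pos_of_gU_pos (hm : 0 ≤ m) {v : ℝ} (hv : 0 < gU m v) : 0 < v := by
  unfold gU at hv
  have := (div_pos_iff_of_pos_right (one_add_pos hm v)).1 hv
  linarith

/-- `V_m ∘ U_m = id` on `m v² < 1`. [bookkeeping] -/
theorem gV_gU (hm : 0 ≤ m) {v : ℝ} (hv : (m : ℝ) * v ^ 2 < 1) : gV m (gU m v) = v :=
  gU_inj hm ((m_gV_sq_le hm _).trans_lt (m_gU_sq_lt hm hv)) hv (gU_gV (m_gU_sq_lt hm hv).le)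

/-- For `m ≥ 1`, `m v² < 1` forces `v² < 1`. [bookkeeping] -/
theorem sq_lt_one_of_m (hm : 1 ≤ m) {v : ℝ} (hv : (m : ℝ) * v ^ 2 < 1) : v ^ 2 < 1 := by
  have hm' : (1 : ℝ) ≤ m := by exact_mod_cast hm
  nlinarith [sq_nonneg v]

end chart

/-! #### 47.3 Preimages under `ℚ`-semialgebraic maps -/

/-- Preimages under `ℚ`-semialgebraic maps: `{x ∈ U | Φ x ∈ T}` is `ℚ`-semialgebraic (projection of
`graph Φ|_U ∩ (ℝᵐ × T)`).  The tree exports this over `ℝ` (`IsSemialgebraicMapOn.isSemialgebraic_sep_mem`)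
and privately over `ℚ` in `PolarChart03`; that proof is repeated here. [BCR1998 Prop. 2.2.7] -/
private theorem isSemialgebraic_sep_mem_chart {m n : ℕ} {U : Set (Fin m → ℝ)}
    {Φ : (Fin m → ℝ) → (Fin n → ℝ)} {T : Set (Fin n → ℝ)} (hΦsa : IsSemialgebraicMapOn ℚ U Φ)
    (hT : IsSemialgebraic ℚ T) : IsSemialgebraic ℚ {x | x ∈ U ∧ Φ x ∈ T} := by
  have hW : IsSemialgebraic ℚ
      ({z : Fin (m + n) → ℝ | ∃ x ∈ U, z = Fin.append x (Φ x)} ∩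
        (fun z : Fin (m + n) → ℝ => z ∘ Fin.natAdd m) ⁻¹' T) :=
    Literature.ModelTheory.ExponentialFields.IsSemialgebraic.inter hΦsa
      (hT.preimage_comp (Fin.natAdd m))
  convert hW.image_castAdd using 1
  ext x
  simp only [mem_setOf_eq, mem_image, mem_inter_iff, mem_preimage]
  constructor
  · rintro ⟨hxU, hxT⟩
    refine ⟨Fin.append x (Φ x), ⟨⟨x, hxU, rfl⟩, ?_⟩, ?_⟩
    · convert hxT using 1
      funext j
      simp
    · funext i
      simp
  · rintro ⟨z, ⟨⟨x', hx', rfl⟩, hzT⟩, rfl⟩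
    have h1 : (fun i => Fin.append x' (Φ x') (Fin.castAdd n i)) = x' := by
      funext i
      simp
    rw [h1]
    refine ⟨hx', ?_⟩
    convert hzT using 1
    funext j
    simp

/-! #### 47.4 The chart domain -/

section dom

variable {e g m : ℚ}

/-- The open chart inequalities `m v² < 1`, `H(x) > 0` (`p 0 = v`, `p 1 = x`). [this node] -/
def hBase (e g m : ℚ) : Set (Fin 2 → ℝ) :=
  {p | (m : ℝ) * p 0 ^ 2 < 1 ∧ 0 < (e : ℝ) * p 1 ^ 2 + g}

/-- The vertex-chart domain over a target `U`: `{(v, x) | m v² < 1, H(x) > 0, Φ(v, x) ∈ U}`. [this node] -/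
def hDom (e g m : ℚ) (U : Set (Fin 2 → ℝ)) : Set (Fin 2 → ℝ) :=
  {p | p ∈ hBase e g m ∧ vΦ m 0 (hP e g) p ∈ U}

/-- Membership in `hBase`. [bookkeeping] -/
theorem mem_hBase {p : Fin 2 → ℝ} :
    p ∈ hBase e g m ↔ (m : ℝ) * p 0 ^ 2 < 1 ∧ 0 < (e : ℝ) * p 1 ^ 2 + g := Iff.rfl

/-- Membership in `hDom`. [bookkeeping] -/
theorem mem_hDom {U : Set (Fin 2 → ℝ)} {p : Fin 2 → ℝ} :
    p ∈ hDom e g m U ↔ ((m : ℝ) * p 0 ^ 2 < 1 ∧ 0 < (e : ℝ) * p 1 ^ 2 + g) ∧ vΦ m 0 (hP e g) p ∈ U :=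
  Iff.rfl

/-- `hBase` is `ℚ`-semialgebraic. [BCR1998 §2.2] -/
theorem isSemialgebraic_hBase (e g m : ℚ) : IsSemialgebraic ℚ (hBase e g m) := by
  have h1 := Literature.ModelTheory.ExponentialFields.isSemialgebraic_setOf_eval_lt (k := ℚ) (R := ℝ)
    (C m * X 0 ^ 2 : MvPolynomial (Fin 2) ℚ) 1
  simp only [map_mul, map_pow, MvPolynomial.aeval_C, MvPolynomial.aeval_X, map_one, eq_ratCast] at h1
  have h2 := Literature.ModelTheory.ExponentialFields.isSemialgebraic_setOf_eval_pos (k := ℚ) (R := ℝ)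
    (C e * X 1 ^ 2 + C g : MvPolynomial (Fin 2) ℚ)
  simp only [map_add, map_mul, map_pow, MvPolynomial.aeval_C, MvPolynomial.aeval_X, eq_ratCast] at h2
  exact h1.inter h2

/-- `hBase` is open. [bookkeeping] -/
theorem isOpen_hBase (e g m : ℚ) : IsOpen (hBase e g m) :=
  (isOpen_lt (f := fun p : Fin 2 → ℝ => (m : ℝ) * p 0 ^ 2) (by fun_prop) continuous_const).inter
    (isOpen_lt (g := fun p : Fin 2 → ℝ => (e : ℝ) * p 1 ^ 2 + g) continuous_const (by fun_prop))

/-- `hDom ⊆ hBase`. [bookkeeping] -/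
theorem hDom_subset_hBase (U : Set (Fin 2 → ℝ)) : hDom e g m U ⊆ hBase e g m := fun _ hp => hp.1

/-- `hDom` is `ℚ`-semialgebraic. [BCR1998 Prop. 2.2.7] -/
theorem isSemialgebraic_hDom (hm : 0 ≤ m) {U : Set (Fin 2 → ℝ)} (hU : IsSemialgebraic ℚ U) :
    IsSemialgebraic ℚ (hDom e g m U) :=
  isSemialgebraic_sep_mem_chart
    (isSemialgebraicMapOn_vΦ (Y₀ := 0) (H := hP e g) hm (isSemialgebraic_hBase e g m)) hU

/-- `hDom` is open for an open target. [bookkeeping] -/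
theorem isOpen_hDom (hm : 0 ≤ m) {U : Set (Fin 2 → ℝ)} (hU : IsOpen U) : IsOpen (hDom e g m U) :=
  (isOpen_hBase e g m).inter (hU.preimage (continuous_vΦ hm 0 (hP e g)))

/-- `R_H ∘ Φ = H(x)·T_m(v)²`. [bookkeeping] -/
theorem hrad_vΦ (hm : 0 ≤ m) (p : Fin 2 → ℝ) (hH : 0 ≤ (e : ℝ) * p 1 ^ 2 + g) :
    hrad e g m (vΦ m 0 (hP e g) p) = ((e : ℝ) * p 1 ^ 2 + g) * gT m (p 0) ^ 2 := by
  have hx : 0 ≤ Polynomial.aeval (p 1) (hP e g) := by rwa [aeval_hP]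
  have h := D_vΦ (Y₀ := 0) hm p hx
  rw [map_zero, sub_zero, aeval_hP] at h
  rw [hrad, vΦ_zero]
  exact h

/-- `R_H ∘ Φ > 0` strictly inside the chart inequalities. [bookkeeping] -/
theorem hrad_vΦ_pos (hm : 0 ≤ m) {p : Fin 2 → ℝ} (hp : p ∈ hBase e g m) :
    0 < hrad e g m (vΦ m 0 (hP e g) p) := by
  rw [hrad_vΦ hm p hp.2.le]
  exact mul_pos hp.2 (pow_pos (gT_pos hm hp.1) 2)

/-- Over a target inside `{R_H > 0}` the chart domain charts exactly the target; the inverse is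
`v = V_m(y/√H(x))`. [this node] -/
theorem image_vΦ_hDom (hm : 0 ≤ m) {U : Set (Fin 2 → ℝ)} (hU : U ⊆ {u | 0 < hrad e g m u}) :
    vΦ m 0 (hP e g) '' hDom e g m U = U := by
  have hm' : (0 : ℝ) ≤ m := by exact_mod_cast hm
  ext u
  constructor
  · rintro ⟨p, hp, rfl⟩
    exact hp.2
  · intro hu
    have hD := hU hu
    simp only [mem_setOf_eq, hrad] at hD
    have hH : 0 < (e : ℝ) * u 0 ^ 2 + g := by nlinarith [mul_nonneg hm' (sq_nonneg (u 1))]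
    have hHa : 0 < Polynomial.aeval (u 0) (hP e g) := by rwa [aeval_hP]
    have hS : 0 < vS (hP e g) (u 0) := vS_pos hHa
    obtain ⟨ρ, hρ⟩ : ∃ ρ : ℝ, ρ = u 1 / vS (hP e g) (u 0) := ⟨_, rfl⟩
    have hρ1 : (m : ℝ) * ρ ^ 2 < 1 := by
      rw [hρ, div_pow, vS_sq hHa.le, aeval_hP, ← mul_div_assoc, div_lt_one hH]
      linarith
    have hΦ : vΦ m 0 (hP e g) ![gV m ρ, u 0] = u := by
      funext i
      have hi : i = 0 ∨ i = 1 := by fin_cases i <;> simp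
      rcases hi with rfl | rfl
      · simp
      · rw [vΦ_one]
        simp only [map_zero, zero_add, Matrix.cons_val_one, Matrix.cons_val_zero,
          Matrix.cons_val_fin_one]
        rw [gU_gV hρ1.le, hρ]
        field_simp
    refine ⟨![gV m ρ, u 0], ⟨⟨?_, ?_⟩, ?_⟩, hΦ⟩
    · simpa using (m_gV_sq_le hm ρ).trans_lt hρ1
    · simpa using hH
    · rw [hΦ]
      exact hu

/-- For `U ⊆ {0 < x < 1, 0 < y}` and `m ≥ 1` the chart domain lies in the open unit square.
[this node] -/
theorem hDom_subset_box (hm : 1 ≤ m) {U : Set (Fin 2 → ℝ)}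
    (hU : U ⊆ {u | 0 < u 0 ∧ u 0 < 1 ∧ 0 < u 1}) :
    hDom e g m U ⊆ {p | ∀ j, 0 < p j ∧ p j < 1} := by
  have hm0 : (0 : ℚ) ≤ m := zero_le_one.trans hm
  intro p hp
  obtain ⟨⟨hv, -⟩, hpU⟩ := hp
  obtain ⟨hx0, hx1, hy⟩ := hU hpU
  rw [vΦ_zero] at hx0 hx1
  rw [vΦ_one, map_zero, zero_add] at hy
  have hgU : 0 < gU m (p 0) := pos_of_mul_pos_right hy (vS_nonneg _ _)
  have hv0 : 0 < p 0 := pos_of_gU_pos hm0 hgU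
  have hv1 : p 0 < 1 := by nlinarith [sq_lt_one_of_m hm hv]
  exact Fin.forall_fin_two.2 ⟨⟨hv0, hv1⟩, hx0, hx1⟩

/-- FRONTIER of the chart domain: the closed chart inequalities hold, and where the strict ones hold
the chart lands in `closure U \ U`. [this node] -/
theorem frontier_hDom (hm : 0 ≤ m) {U : Set (Fin 2 → ℝ)} (hUo : IsOpen U) {p : Fin 2 → ℝ}
    (hp : p ∈ frontier (hDom e g m U)) :
    ((m : ℝ) * p 0 ^ 2 ≤ 1 ∧ 0 ≤ (e : ℝ) * p 1 ^ 2 + g) ∧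
      (p ∈ hBase e g m → vΦ m 0 (hP e g) p ∈ closure U ∧ vΦ m 0 (hP e g) p ∉ U) := by
  have hW := isOpen_hDom (e := e) (g := g) hm hUo
  rw [hW.frontier_eq] at hp
  obtain ⟨hpc, hpW⟩ := hp
  refine ⟨⟨?_, ?_⟩, fun hb => ⟨?_, fun hU => hpW ⟨hb, hU⟩⟩⟩
  · have hc : IsClosed {q : Fin 2 → ℝ | (m : ℝ) * q 0 ^ 2 ≤ 1} :=
      isClosed_le (by fun_prop) continuous_const
    exact closure_minimal (fun q hq => (le_of_lt hq.1.1 : (m : ℝ) * q 0 ^ 2 ≤ 1)) hc hpc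
  · have hc : IsClosed {q : Fin 2 → ℝ | 0 ≤ (e : ℝ) * q 1 ^ 2 + g} :=
      isClosed_le continuous_const (by fun_prop)
    exact closure_minimal (fun q hq => (le_of_lt hq.1.2 : (0 : ℝ) ≤ (e : ℝ) * q 1 ^ 2 + g)) hc hpc
  · exact map_mem_closure (continuous_vΦ hm 0 (hP e g)) hpc fun q hq => hq.2

/-! #### 47.5 The potential and the raw-section engine -/

/-- The potential `P(v, x) = γ·Hi(x)·g_m(v)` on the chart plane (`p 0 = v`, `p 1 = x`);
`∂P/∂x = γ·H(x)·g_m(v)` is the pulled-back weight. [this node] -/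
def hpot (γ e g m : ℚ) (p : Fin 2 → ℝ) : ℝ := vF m (hPi e g) γ (p 1) (p 0)

/-- `P` explicitly. [bookkeeping] -/
theorem hpot_eq (γ e g m : ℚ) (p : Fin 2 → ℝ) :
    hpot γ e g m p = (γ : ℝ) * ((e : ℝ) / 3 * p 1 ^ 3 + g * p 1) * gW m (p 0) := by
  rw [hpot, vF, aeval_hPi]

/-- `P` is continuous. [calculus] -/
theorem continuous_hpot (hm : 0 ≤ m) (γ e g : ℚ) : Continuous (hpot γ e g m) := by
  have h : Continuous fun p : Fin 2 → ℝ =>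
      (γ : ℝ) * ((e : ℝ) / 3 * p 1 ^ 3 + g * p 1) * gW m (p 0) :=
    (continuous_const.mul (by fun_prop)).mul ((continuous_gW hm).comp (continuous_apply 0))
  exact h.congr fun p => (hpot_eq γ e g m p).symm

/-- `P` is `ℚ`-semialgebraic. [BCR1998 §2.2] -/
theorem isSemialgebraicFunOn_hpot (hm : 0 ≤ m) (γ e g : ℚ) :
    IsSemialgebraicFunOn ℚ univ (hpot γ e g m) :=
  Summit.KontsevichZagierPeriods.RootDecompWalshStrata.ConicDescent.VertexChart.isSemialgebraicFunOn_weight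
    (H := hPi e g) hm isSemialgebraic_univ γ

/-- `∂P/∂x` along the last coordinate. [calculus] -/
theorem hasDerivAt_hpot_snoc (γ e g m : ℚ) (z : Fin 2 → ℝ) :
    HasDerivAt (fun s => hpot γ e g m (Fin.snoc (Fin.init z) s))
      ((γ : ℝ) * Polynomial.aeval (z 1) (hP e g) * gW m (z 0)) (z (Fin.last 1)) := by
  have h : (fun s => hpot γ e g m (Fin.snoc (Fin.init z) s)) =
      fun s => vF m (hPi e g) γ s (z 0) := by
    funext s
    rw [hpot, snoc_init_zero, snoc_init_one]
  rw [h, show z (Fin.last 1) = z 1 from rfl]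
  exact hasDerivAt_vF (m := m) (derivative_hPi e g) γ (z 1) (z 0)

/-- `P = 0` on the chart line `m v² = 1` (`g_m` vanishes there). [bookkeeping] -/
theorem hpot_eq_zero_of_sq (γ e g : ℚ) {p : Fin 2 → ℝ} (hp : (m : ℝ) * p 0 ^ 2 = 1) :
    hpot γ e g m p = 0 := by
  rw [hpot_eq, gW, show (1 : ℝ) - (m : ℝ) * p 0 ^ 2 = 0 by linarith]
  simp

/-- **The H-type chart engine (raw sections).** For an open `σ.domain ⊆ {0 < x < 1, 0 < y}` on which
`R_H = e x² + g − m y² > 0`, `m ≥ 1`, and `σ.integrand = γ√R_H`: `[σ] ∈ InBaker` as soon as the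
boundary-section terms `[S, P(v, ζ(v))]` of the potential over the chart domain `hDom e g m σ.domain`
are (rule (2) for the chart `Φ`, whose pull-back `γ·H(x)·g_m(v)` is RATIONAL; rule (3) in `x` and the
`v`-ordered CAD, all inside `InBaker.of_planar_sections`). [KontsevichZagier2001 §1.2 rules (2),(3);
this node] -/
theorem InBaker.of_Hhalf (hm : 1 ≤ m) (γ e g : ℚ) (σ : KZ.IntegralRep 2) (hσo : IsOpen σ.domain)
    (hσT : σ.domain ⊆ {u | 0 < u 0 ∧ u 0 < 1 ∧ 0 < u 1})
    (hD : ∀ u ∈ σ.domain, 0 < hrad e g m u)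
    (hσi : ∀ u ∈ σ.domain, σ.integrand u = (γ : ℝ) * √(hrad e g m u))
    (hsec : ∀ (S : Set (Fin 1 → ℝ)) (ζ : (Fin 1 → ℝ) → ℝ), IsSemialgebraic ℚ S →
      IsSemialgebraicFunOn ℚ S ζ → ContinuousOn ζ S →
      (∀ b ∈ S, Fin.snoc b (ζ b) ∈ frontier (hDom e g m σ.domain)) →
      ∀ r₁ : KZ.IntegralRep 1, r₁.domain = S →
        EqOn r₁.integrand (fun b => hpot γ e g m (Fin.snoc b (ζ b))) S → InBaker (KZ.of r₁)) :
    InBaker (KZ.of σ) := by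
  have hm0 : (0 : ℚ) ≤ m := zero_le_one.trans hm
  have hm1 : (0 : ℚ) < m := zero_lt_one.trans_le hm
  have hWs : IsSemialgebraic ℚ (hDom e g m σ.domain) :=
    isSemialgebraic_hDom hm0 σ.isSemialgebraic_domain
  have hWo : IsOpen (hDom e g m σ.domain) := isOpen_hDom hm0 hσo
  have hWB := hDom_subset_box (e := e) (g := g) hm hσT
  have hWI : hDom e g m σ.domain ⊆ Icc 0 1 := fun p hp =>
    ⟨fun j => ((hWB hp) j).1.le, fun j => ((hWB hp) j).2.le⟩
  have hb : Bornology.IsBounded (hDom e g m σ.domain) :=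
    (Metric.isBounded_Icc (0 : Fin 2 → ℝ) 1).subset hWI
  have hM : ∀ p ∈ hDom e g m σ.domain, |Polynomial.aeval (p 1) (hP e g)| ≤ |(e : ℝ)| + |(g : ℝ)| :=
    fun p hp => by
      rw [aeval_hP]
      have hx := (hWB hp) 1
      have hx2 : p 1 ^ 2 ≤ 1 := by nlinarith [hx.1, hx.2]
      calc |(e : ℝ) * p 1 ^ 2 + g| ≤ |(e : ℝ) * p 1 ^ 2| + |(g : ℝ)| := abs_add_le _ _
        _ ≤ |(e : ℝ)| + |(g : ℝ)| := by
            rw [abs_mul, abs_of_nonneg (sq_nonneg (p 1))]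
            nlinarith [abs_nonneg (e : ℝ)]
  have hdom : ∀ p ∈ (srcRep m hm0 (hP e g) γ _ hWs hb _ hM).domain,
      (m : ℝ) * p 0 ^ 2 < 1 ∧ 0 < Polynomial.aeval (p 1) (hP e g) := fun p hp => by
    have h := hDom_subset_hBase _ hp
    exact ⟨h.1, by rw [aeval_hP]; exact h.2⟩
  have hrel := vchart_mem_relations (Y₀ := 0) (H := hP e g) hm1 γ
    (srcRep m hm0 (hP e g) γ _ hWs hb _ hM) σ hdom (fun p _ => rfl)
    (by
      show σ.domain = vΦ m 0 (hP e g) '' hDom e g m σ.domain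
      rw [image_vΦ_hDom hm0 fun u hu => hD u hu])
    (fun u hu => by rw [hσi u hu, hrad_eq_vertex])
  have hρB : InBaker (KZ.of (srcRep m hm0 (hP e g) γ _ hWs hb _ hM)) :=
    InBaker.of_planar_sections (N := 1) hWo hWs hWI (hpot γ e g m)
      (isSemialgebraicFunOn_hpot hm0 γ e g) (continuous_hpot hm0 γ e g) _ rfl
      (fun z _ => hasDerivAt_hpot_snoc γ e g m z) hsec
  exact hρB.congr (by rw [← neg_sub]; exact KZ.relations.neg_mem hrel)

end dom

end Summit.KontsevichZagierPeriods.RootDecompWalshStrata.ConicDescent.BallCube
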